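import Summits.QuantumAdvantage.QuantumAdvantage.Theorems.MobiusLadderLiouvilleNotPPolyOneTimePad
import Literature.Computability.Complexity.HardCoreMinMax
import Literature.Computability.Complexity.CircuitClassesProofs
import HarnessLib

/-!
# Crux `MobiusLadder.LiouvilleNotPPoly` (stmt-QuantumAdvantage-1389), line `SketchIdeator4`, stub `stub_hardcoreInstances` (T2b)

Impagliazzo's HARD-CORE MEASURE on the instances of length `n`, from the `1/poly` average-case
hardness `MildAvgHard c` of `[λ(N) = -1]` on `N ∈ U = [2^{n-1}, 2^n)`: for every size polynomial
`q` and `ε₁ > 0`, for all large `n` there is a measure `M : ℕ → [0,1]` of density between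
`n^{-c}` and `2 n^{-c}` on `U` against which every `B₂`-circuit of size `≤ q(n)` has
`λ`-correlation `≤ ε₁ · ∑_{u ∈ U} M(u)`.

Proof (all ingredients in the tree). Write `n = j + 1` and transport the instances to the cube
`{0,1}^j` of low digits (`u = 2^j + Nat.ofBits x ↔ x = bits j u`, `sum_Ico_eq_sum_cube`). The
hard function is `x ↦ lamBit (2^j + Nat.ofBits x)`. `MildAvgHard c` at the size polynomial
`(2m+1)(q+3) + 9m + 3` (`m = E n`, `E = ⌈8/ε₁²⌉`) says every `B₂`-circuit on `j` inputs of that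
size (extended to `j+1` inputs for free, `CktSize.rewire`) errs on `≥ k = ⌈2^j / n^c⌉` points of
the cube; the tree's min-max hard-core lemma `HardCoreMinMax.exists_hardCore_measure` then gives
a probability distribution `p ≤ 1/k` on the cube under which every circuit of size `≤ q(n) + 3`
agrees with the hard function with probability `≤ 1/2 + ε₁/2`. Applied to the restriction
`x ↦ D(x, 1)` of a circuit `D` on `j+1` digits (`CktSize.hardwire`, two gates) and to its
negation (one more gate) this pins the agreement to `1/2 ± ε₁/2`, i.e. `|correlation| ≤ ε₁ · k`;
the measure is `M(u) = k · p(bits j u)`, of total mass `k ∈ [2^j/n^c, 2^j/n^c + 1)`.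

Sources: R. Impagliazzo, *Hard-core distributions for somewhat hard problems*, FOCS 1995,
Thm. 1; S. Arora, B. Barak, *Computational Complexity* (2009), Thm. 19.2 (the hard-core lemma,
as proved in `Literature/Computability/Complexity/HardCoreMinMax.lean`), Def. 6.1 (circuits).
No new definitions: the extension by the top digit is Mathlib's `Fin.snoc`, the digits-to-number
map is Batteries' `Nat.ofBits`.
-/

set_option linter.dupNamespace false -- D-0017: single-problem summit ⇒ `QuantumAdvantage.QuantumAdvantage` by design

noncomputable section

namespace Summit.QuantumAdvantage.QuantumAdvantage.Theorems.LiouvilleNotPPoly.OneTimePad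

open Literature.Computability.Complexity
open Literature.Probability.RandomGraphs.LowDegree (sgn sgn_true sgn_false)
open _root_.Computability Filter Finset Polynomial
open Summit.QuantumAdvantage.QuantumAdvantage.Theorems.MobiusLadder
open Summit.QuantumAdvantage.QuantumAdvantage.Theorems.LiouvilleOrthogonalTC0 (bits ofBits lamBit)

namespace HardcoreInstances

/-! ### The cube of low digits: `u = 2^j + Nat.ofBits x ↔ x = bits j u` -/

/-- The low `j` digits of `2^j + Nat.ofBits x` are `x`. [folklore] -/
theorem bits_two_pow_add_ofBits {j : ℕ} (x : Fin j → Bool) :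
    bits j (2 ^ j + Nat.ofBits x) = x := by
  funext i
  show Nat.testBit (2 ^ j + Nat.ofBits x) i = x i
  rw [Nat.testBit_two_pow_add_gt i.isLt, Nat.testBit_ofBits_lt x i i.isLt]

/-- An instance `u ∈ [2^j, 2^(j+1))` is `2^j` plus the number with digits `bits j u`.
[folklore] -/
theorem two_pow_add_ofBits_bits {j u : ℕ} (h₁ : 2 ^ j ≤ u) (h₂ : u < 2 ^ (j + 1)) :
    2 ^ j + Nat.ofBits (bits j u) = u := by
  have h : Nat.ofBits (bits j u) = u % 2 ^ j := Nat.ofBits_testBit u j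
  rw [h, Nat.mod_eq_sub_mod h₁, Nat.mod_eq_of_lt (by rw [pow_succ] at h₂; omega)]
  omega

/-- **Reindexing the instances by the cube.** `u ↦ bits j u` is a bijection from
`[2^j, 2^(j+1))` onto `{0,1}^j` (inverse `x ↦ 2^j + Nat.ofBits x`), so a sum over the instances
of a function of the low digits is the corresponding sum over the cube. [folklore] -/
theorem sum_Ico_eq_sum_cube {M : Type*} [AddCommMonoid M] (j : ℕ) (F : ℕ → M)
    (φ : (Fin j → Bool) → M) (h : ∀ u ∈ Ico (2 ^ j) (2 ^ (j + 1)), F u = φ (bits j u)) :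
    ∑ u ∈ Ico (2 ^ j) (2 ^ (j + 1)), F u = ∑ x : Fin j → Bool, φ x := by
  refine Finset.sum_nbij' (bits j) (fun x => 2 ^ j + Nat.ofBits x) ?_ ?_ ?_ ?_ h
  · intro u _
    exact mem_univ _
  · intro x _
    have hx := Nat.ofBits_lt_two_pow x
    rw [mem_Ico, pow_succ]
    constructor <;> omega
  · intro u hu
    rw [mem_Ico] at hu
    exact two_pow_add_ofBits_bits hu.1 hu.2
  · intro x _
    exact bits_two_pow_add_ofBits x

/-! ### Restricting a circuit on `j+1` digits to top digit `1` -/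

/-- The `j+1` low digits of an instance `u ∈ [2^j, 2^(j+1))` are its `j` low digits extended by
the top digit `1` (`Fin.snoc`). [folklore] -/
theorem bits_succ_eq_snoc {j u : ℕ} (h₁ : 2 ^ j ≤ u) (h₂ : u < 2 ^ (j + 1)) :
    bits (j + 1) u = Fin.snoc (bits j u) true := by
  funext i
  induction i using Fin.lastCases with
  | last =>
    rw [Fin.snoc_last]
    exact testBit_eq_true_of_two_pow_le h₁ h₂
  | cast i =>
    rw [Fin.snoc_castSucc]
    rfl

/-- **Restriction and its negation as circuits.** For a `B₂`-circuit `D` on `j+1` inputs, the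
restriction `x ↦ D(x, 1)` (`Fin.snoc x true`) is a `B₂`-circuit on `j` inputs with two more gates
(the free rewiring `Fin.snoc inl (inr ())` of the inputs, then hardwiring, `CktSize.hardwire`),
and its negation costs one further gate (Arora–Barak 2009, proof of Thm. 7.14; the tree's
straight-line calculus `CktSize`). [folklore] -/
theorem exists_restrict_circuits {j : ℕ} (D : Circuit (Fin (j + 1))) (hD : D.IsOver B2) :
    (∃ G : Circuit (Fin j), G.IsOver B2 ∧ G.size ≤ D.size + 2 ∧
      ∀ x, G.eval x = D.eval (Fin.snoc x true)) ∧
    (∃ G' : Circuit (Fin j), G'.IsOver B2 ∧ G'.size ≤ D.size + 2 + 1 ∧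
      ∀ x, G'.eval x = !D.eval (Fin.snoc x true)) := by
  have h1 : CktSize B2 (fun (x : Fin j → Bool) (_ : Unit) => D.eval (Fin.snoc x true))
      (D.size + 2) := by
    refine (((D.cktSize_eval hD).rewire
      (Fin.snoc (fun i : Fin j => (Sum.inl i : Fin j ⊕ Unit)) (Sum.inr ()))).hardwire
        fun _ => true).congr fun x _ => ?_
    show D.eval _ = D.eval _
    congr 1
    funext i
    induction i using Fin.lastCases with
    | last => simp only [Fin.snoc_last, Sum.elim_inr]
    | cast i => simp only [Fin.snoc_castSucc, Sum.elim_inl]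
  have h2 : CktSize B2 (fun (x : Fin j → Bool) (_ : Unit) => !D.eval (Fin.snoc x true))
      (D.size + 2 + 1) :=
    (h1.comp (cktSize_not ())).congr fun _ _ => rfl
  exact ⟨h1.toCircuit, h2.toCircuit⟩

/-! ### Signs -/

/-- `λ(u) = -1` if `lamBit u`, else `λ(u) = 1` (for `u ≠ 0`). [folklore] -/
theorem cast_liouville_eq_ite {u : ℕ} (hu : u ≠ 0) :
    ((ArithmeticFunction.liouville u : ℤ) : ℝ) = if lamBit u then -1 else 1 := by
  rcases liouville_eq_one_or_eq_neg_one hu with h | h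
  · have hl : lamBit u = false := by
      show decide (ArithmeticFunction.liouville u = -1) = false
      rw [h]
      decide
    rw [h, hl]
    norm_num
  · have hl : lamBit u = true := by
      show decide (ArithmeticFunction.liouville u = -1) = true
      rw [h]
      decide
    rw [h, hl]
    norm_num

/-- Correlation versus agreement, one term: with the route's convention `sgn true = -1`, the
sign `λ · sgn a` is `+1` exactly when the verdict `a` agrees with `b = [λ = -1]`. [folklore] -/
theorem mul_sgn_eq (a b : Bool) {lam : ℝ} (hl : lam = if b then -1 else 1) :
    lam * sgn a = 2 * (if a = b then 1 else 0) - 1 := by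
  subst hl
  cases a <;> cases b <;> norm_num [sgn_true, sgn_false]

/-! ### Real-analysis side conditions -/

/-- The amplification parameter fits: `2^j · exp(-(2m+1) ε²/2) < 1` as soon as
`m ε² ≥ j + 1` (`2 ≤ e`). [folklore] -/
theorem two_pow_mul_exp_lt_one {j m : ℕ} {ε : ℝ} (hε : 0 < ε)
    (h : (j : ℝ) + 1 ≤ (m : ℝ) * ε ^ 2) :
    (2 ^ j : ℝ) * Real.exp (-((2 * m + 1 : ℕ) * ε ^ 2 / 2)) < 1 := by
  rw [Real.exp_neg, ← div_eq_mul_inv, div_lt_one (Real.exp_pos _)]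
  have h2 : (2 : ℝ) ≤ Real.exp 1 := by
    have := Real.add_one_le_exp (1 : ℝ)
    norm_num at this
    exact this
  have hlt : (j : ℝ) < ((2 * m + 1 : ℕ) : ℝ) * ε ^ 2 / 2 := by
    have hε2 : 0 < ε ^ 2 := by positivity
    have h3 : ((2 * m + 1 : ℕ) : ℝ) * ε ^ 2 / 2 = (m : ℝ) * ε ^ 2 + ε ^ 2 / 2 := by
      push_cast
      ring
    rw [h3]
    linarith
  calc (2 : ℝ) ^ j ≤ Real.exp 1 ^ j := pow_le_pow_left₀ (by norm_num) h2 j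
    _ = Real.exp (j : ℝ) := by rw [← Real.exp_nat_mul, mul_one]
    _ < Real.exp (((2 * m + 1 : ℕ) : ℝ) * ε ^ 2 / 2) := Real.exp_lt_exp.2 hlt

/-- Polynomials are eventually below `2^(n-1)`: `n^c ≤ 2^(n-1)` for all large `n`. [folklore] -/
theorem eventually_pow_le_two_pow (c : ℕ) :
    ∀ᶠ n : ℕ in atTop, (n : ℝ) ^ c ≤ (2 : ℝ) ^ (n - 1) := by
  have h := tendsto_pow_const_div_const_pow_of_one_lt c (show (1 : ℝ) < 2 by norm_num)
  filter_upwards [h.eventually (gt_mem_nhds (show (0 : ℝ) < 1 / 2 by norm_num)),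
    eventually_ge_atTop 1] with n hn hn1
  obtain ⟨j, rfl⟩ : ∃ j, n = j + 1 := ⟨n - 1, by omega⟩
  rw [Nat.add_sub_cancel]
  rw [div_lt_iff₀ (by positivity), pow_succ] at hn
  linarith

/-! ### The hard-core measure on the instances of one length -/

/-- **Core of the stub** (one length `n = j + 1`, all largeness conditions as hypotheses). If
every `B₂`-circuit on `j+1` digits of size `≤ (2m+1)(s_D+3) + 9m + 3` errs on the instances
`U = [2^j, 2^(j+1))` at rate `≥ 1/ν` (`2^j ≤ ν · disagree`), the amplification fits
(`2^j e^{-(2m+1)ε²/2} < 1`) and `ν ≤ 2^j`, then there is `M : ℕ → [0,1]` with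
`2^j ≤ ν ∑_U M ≤ 2 · 2^j` and `|∑_U M(u) λ(u) sgn D(bits u)| ≤ 2ε ∑_U M` for every `B₂`-circuit
`D` of size `≤ s_D` — by `HardCoreMinMax.exists_hardCore_measure` for the hard function
`x ↦ lamBit (2^j + Nat.ofBits x)` on the cube of low digits (Arora–Barak 2009, Thm. 19.2).
[folklore] -/
theorem core {j sD m : ℕ} {ε ν : ℝ} (hε : 0 < ε) (hν0 : 0 < ν) (hdn : ν ≤ (2 : ℝ) ^ j)
    (hm : (2 ^ j : ℝ) * Real.exp (-((2 * m + 1 : ℕ) * ε ^ 2 / 2)) < 1)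
    (hhard : ∀ C : Circuit (Fin (j + 1)), C.IsOver B2 →
      C.size ≤ (2 * m + 1) * (sD + 3) + (9 * m + 3) → (2 : ℝ) ^ j ≤ ν * disagree (j + 1) C) :
    ∃ M : ℕ → ℝ, (∀ u, 0 ≤ M u ∧ M u ≤ 1) ∧
      (2 : ℝ) ^ j ≤ ν * ∑ u ∈ Ico (2 ^ j) (2 ^ (j + 1)), M u ∧
      ν * ∑ u ∈ Ico (2 ^ j) (2 ^ (j + 1)), M u ≤ 2 * (2 : ℝ) ^ j ∧
      ∀ D : Circuit (Fin (j + 1)), D.IsOver B2 → D.size ≤ sD →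
        |∑ u ∈ Ico (2 ^ j) (2 ^ (j + 1)),
            M u * ((ArithmeticFunction.liouville u : ℤ) : ℝ) * sgn (D.eval (bits (j + 1) u))| ≤
          2 * ε * ∑ u ∈ Ico (2 ^ j) (2 ^ (j + 1)), M u := by
  -- the hard function `f x = lamBit (2^j + Nat.ofBits x)` on the cube of low digits
  obtain ⟨f, hf⟩ : ∃ f : (Fin j → Bool) → Bool, ∀ x, f x = lamBit (2 ^ j + Nat.ofBits x) :=
    ⟨_, fun _ => rfl⟩
  have hfu : ∀ u ∈ Ico (2 ^ j) (2 ^ (j + 1)), f (bits j u) = lamBit u := fun u hu => by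
    rw [mem_Ico] at hu
    rw [hf, two_pow_add_ofBits_bits hu.1 hu.2]
  -- the hardness parameter `k = ⌈2^j / ν⌉`
  obtain ⟨k, hk1, hkle, hklt, hkN⟩ : ∃ k : ℕ, 1 ≤ k ∧ (2 : ℝ) ^ j / ν ≤ k ∧
      (k : ℝ) < (2 : ℝ) ^ j / ν + 1 ∧ ∀ N : ℕ, (2 : ℝ) ^ j / ν ≤ N → k ≤ N :=
    ⟨⌈(2 : ℝ) ^ j / ν⌉₊, Nat.ceil_pos.2 (div_pos (by positivity) hν0), Nat.le_ceil _,
      Nat.ceil_lt_add_one (div_pos (by positivity) hν0).le, fun N hN => Nat.ceil_le.2 hN⟩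
  have hk0 : (0 : ℝ) < k := by exact_mod_cast hk1
  -- hardness of `f` on the cube against size `(2m+1)(sD+3) + 9m + 3`: a circuit on `j` inputs is
  -- a circuit on `j+1` inputs (`CktSize.rewire`), and its errors on `U` are its errors on the cube
  have hhard' : ∀ C : Circuit (Fin j), C.IsOver B2 →
      C.size ≤ (2 * m + 1) * (sD + 3) + (9 * m + 3) →
        k ≤ (Finset.univ.filter fun x => C.eval x ≠ f x).card := by
    intro C' hC' hsz
    obtain ⟨C, hCB, hCs, hCe⟩ :=
      ((C'.cktSize_eval hC').rewire (ι' := Fin (j + 1)) Fin.castSucc).toCircuit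
    have h1 := hhard C hCB (hCs.trans hsz)
    have h2 : disagree (j + 1) C = (Finset.univ.filter fun x => C'.eval x ≠ f x).card := by
      unfold disagree
      rw [Finset.card_filter, Finset.card_filter, Nat.add_sub_cancel]
      refine sum_Ico_eq_sum_cube j _ (fun x => if C'.eval x ≠ f x then 1 else 0) fun u hu => ?_
      have he : C.eval (bits (j + 1) u) = C'.eval (bits j u) := hCe _
      rw [he, hfu u hu]
    rw [h2] at h1
    refine hkN _ ?_
    rw [div_le_iff₀' hν0]
    exact h1
  -- the hard-core measure `p` (density `k`) of the min-max hard-core lemma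
  obtain ⟨p, hp0, hp1, hpk, hpC⟩ := HardCoreMinMax.exists_hardCore_measure f hε hk1
    (show 1 ≤ sD + 3 by omega) le_rfl hm hhard'
  refine ⟨fun u => k * p (bits j u), fun u => ⟨mul_nonneg hk0.le (hp0 _), ?_⟩, ?_⟩
  · calc (k : ℝ) * p (bits j u) ≤ k * (1 / k) := mul_le_mul_of_nonneg_left (hpk _) hk0.le
      _ = 1 := by field_simp
  -- total mass `k`
  have hmass : ∑ u ∈ Ico (2 ^ j) (2 ^ (j + 1)), (k : ℝ) * p (bits j u) = k := by
    rw [sum_Ico_eq_sum_cube j (fun u => (k : ℝ) * p (bits j u)) (fun x => (k : ℝ) * p x)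
      fun u _ => rfl, ← Finset.mul_sum, hp1, mul_one]
  rw [hmass]
  refine ⟨?_, ?_, ?_⟩
  · -- density from below: `2^j / ν ≤ k`
    rw [div_le_iff₀' hν0] at hkle
    exact hkle
  · -- density from above: `ν k < 2^j + ν ≤ 2 · 2^j`
    have h1 : (k : ℝ) - 1 < (2 : ℝ) ^ j / ν := by linarith
    rw [lt_div_iff₀' hν0, mul_sub, mul_one] at h1
    linarith
  · intro D hD hDs
    obtain ⟨⟨G, hG, hGs, hGe⟩, ⟨G', hG', hG's, hG'e⟩⟩ := exists_restrict_circuits D hD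
    -- `p`-agreement `A` of the restriction `G` with `f`: `A ≤ 1/2 + ε` and, from the negation
    -- `G'`, `1 - A ≤ 1/2 + ε`
    have hA1 : ∑ x, p x * (if G.eval x = f x then 1 else 0) ≤ 1 / 2 + ε := hpC G hG (by omega)
    have hA2 : 1 - ∑ x, p x * (if G.eval x = f x then 1 else 0) ≤ 1 / 2 + ε := by
      have h := hpC G' hG' (by omega)
      have heq : ∑ x, p x * (if G'.eval x = f x then 1 else 0) =
          1 - ∑ x, p x * (if G.eval x = f x then 1 else 0) := by
        calc ∑ x, p x * (if G'.eval x = f x then 1 else 0)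
            = ∑ x, (p x - p x * (if G.eval x = f x then 1 else 0)) := by
              refine Finset.sum_congr rfl fun x _ => ?_
              rw [hG'e, hGe]
              cases f x <;> cases D.eval (Fin.snoc x true) <;> simp
          _ = 1 - ∑ x, p x * (if G.eval x = f x then 1 else 0) := by
              rw [Finset.sum_sub_distrib, hp1]
      rw [heq] at h
      exact h
    -- the correlation sum, term by term: `M(u) λ(u) sgn D(bits u) = k p(x) (2 [G x = f x] - 1)`
    have hpt : ∀ u ∈ Ico (2 ^ j) (2 ^ (j + 1)),
        (k : ℝ) * p (bits j u) * ((ArithmeticFunction.liouville u : ℤ) : ℝ) *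
            sgn (D.eval (bits (j + 1) u)) =
          (k : ℝ) * (2 * (p (bits j u) * (if G.eval (bits j u) = f (bits j u) then 1 else 0)) -
            p (bits j u)) := by
      intro u hu
      have hu0 : u ≠ 0 := by
        have := Nat.one_le_two_pow (n := j)
        have := (mem_Ico.1 hu).1
        omega
      rw [bits_succ_eq_snoc (mem_Ico.1 hu).1 (mem_Ico.1 hu).2, ← hGe, hfu u hu,
        mul_assoc ((k : ℝ) * p (bits j u)),
        mul_sgn_eq (G.eval (bits j u)) (lamBit u) (cast_liouville_eq_ite hu0)]
      ring
    have hT : ∑ u ∈ Ico (2 ^ j) (2 ^ (j + 1)),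
        (k : ℝ) * p (bits j u) * ((ArithmeticFunction.liouville u : ℤ) : ℝ) *
            sgn (D.eval (bits (j + 1) u)) =
          k * (2 * (∑ x, p x * (if G.eval x = f x then 1 else 0)) - 1) := by
      rw [sum_Ico_eq_sum_cube j _
          (fun x => (k : ℝ) * (2 * (p x * (if G.eval x = f x then 1 else 0)) - p x)) hpt,
        ← Finset.mul_sum, Finset.sum_sub_distrib, ← Finset.mul_sum, hp1]
    rw [hT, abs_mul, abs_of_pos hk0]
    have hab : |2 * (∑ x, p x * (if G.eval x = f x then 1 else 0)) - 1| ≤ 2 * ε :=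
      abs_le.2 ⟨by linarith, by linarith⟩
    calc (k : ℝ) * |2 * (∑ x, p x * (if G.eval x = f x then 1 else 0)) - 1|
        ≤ k * (2 * ε) := mul_le_mul_of_nonneg_left hab hk0.le
      _ = 2 * ε * k := by ring

end HardcoreInstances

open HardcoreInstances

/-- **STUB T2b · `stub_hardcoreInstances` — Impagliazzo's hard-core measure on the instances.**
Under `MildAvgHard c`, for every size polynomial `q` and `ε₁ > 0`, for all large `n` there is a
measure `M : ℕ → [0,1]` on the instances `U = [2^{n-1}, 2^n)` of density between `n^{-c}` and
`2 n^{-c}` against which every `B₂`-circuit `D` of size `≤ q(n)` (read on the `n` digits) has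
`λ`-correlation `|∑_{u ∈ U} M(u) λ(u) sgn D(bits u)| ≤ ε₁ ∑_{u ∈ U} M(u)`. Proof: `MildAvgHard c`
at the polynomial size `(2m+1)(q+3) + 9m + 3`, `m = E n`, `E = ⌈8/ε₁²⌉`, transported to the cube
`{0,1}^{n-1}` of low digits (`u = 2^{n-1} + Nat.ofBits x`; `CktSize.rewire`), is
`k = ⌈2^{n-1}/n^c⌉`-hardness of `x ↦ lamBit (2^{n-1} + Nat.ofBits x)`;
`HardCoreMinMax.exists_hardCore_measure` (agreement `≤ 1/2 + ε₁/2` for size `≤ q(n) + 3`,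
applied to the restriction `D|_{x_{n-1}=1}` (`CktSize.hardwire`, `+2`) and to its negation
(`+1`)) gives `p ≤ 1/k`; take `M(u) = k · p(bits (n-1) u)` (`HardcoreInstances.core`), once
`n^c ≤ 2^{n-1}` (`eventually_pow_le_two_pow`). (Impagliazzo 1995, Thm. 1; Arora–Barak 2009,
Thm. 19.2.) [folklore] -/
theorem stub_hardcoreInstances :
    ∀ c : ℕ, MildAvgHard c → ∀ q : Polynomial ℕ, ∀ ε₁ : ℝ, 0 < ε₁ →
      ∀ᶠ n : ℕ in atTop, ∃ M : ℕ → ℝ, (∀ u, 0 ≤ M u ∧ M u ≤ 1) ∧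
        (2 : ℝ) ^ (n - 1) ≤ (n : ℝ) ^ c * ∑ u ∈ Finset.Ico (2 ^ (n - 1)) (2 ^ n), M u ∧
        (n : ℝ) ^ c * ∑ u ∈ Finset.Ico (2 ^ (n - 1)) (2 ^ n), M u ≤ 2 * (2 : ℝ) ^ (n - 1) ∧
        ∀ D : Circuit (Fin n), D.IsOver B2 → D.size ≤ q.eval n →
          |∑ u ∈ Finset.Ico (2 ^ (n - 1)) (2 ^ n),
              M u * ((ArithmeticFunction.liouville u : ℤ) : ℝ) * sgn (D.eval (bits n u))| ≤
            ε₁ * ∑ u ∈ Finset.Ico (2 ^ (n - 1)) (2 ^ n), M u := by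
  intro c H q ε₁ hε₁
  have hε : (0 : ℝ) < ε₁ / 2 := by positivity
  -- the amplification constant `E ≥ 2/ε²` (`ε = ε₁/2`) and the size polynomial of the hardness
  obtain ⟨E, hE⟩ : ∃ E : ℕ, 2 / (ε₁ / 2) ^ 2 ≤ (E : ℝ) := ⟨⌈2 / (ε₁ / 2) ^ 2⌉₊, Nat.le_ceil _⟩
  have hE2 : (2 : ℝ) ≤ (E : ℝ) * (ε₁ / 2) ^ 2 := (div_le_iff₀ (by positivity)).1 hE
  set P : Polynomial ℕ := (2 * (C E * X) + 1) * (q + 3) + (9 * (C E * X) + 3) with hPdef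
  filter_upwards [H P, eventually_pow_le_two_pow c, eventually_ge_atTop 1] with n hn hdn hn1
  obtain ⟨j, rfl⟩ : ∃ j, n = j + 1 := ⟨n - 1, by omega⟩
  simp only [Nat.add_sub_cancel] at hn hdn ⊢
  have hPev : P.eval (j + 1) =
      (2 * (E * (j + 1)) + 1) * (q.eval (j + 1) + 3) + (9 * (E * (j + 1)) + 3) := by
    simp only [hPdef, eval_add, eval_mul, eval_ofNat, eval_one, eval_C, eval_X]
  have hn' : ∀ C : Circuit (Fin (j + 1)), C.IsOver B2 →
      C.size ≤ (2 * (E * (j + 1)) + 1) * (q.eval (j + 1) + 3) + (9 * (E * (j + 1)) + 3) →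
        (2 : ℝ) ^ j ≤ ((j + 1 : ℕ) : ℝ) ^ c * disagree (j + 1) C :=
    fun C hC hs => hn C hC (by rw [hPev]; exact hs)
  have hjm : (j : ℝ) + 1 ≤ ((E * (j + 1) : ℕ) : ℝ) * (ε₁ / 2) ^ 2 :=
    calc (j : ℝ) + 1 ≤ ((j : ℝ) + 1) * ((E : ℝ) * (ε₁ / 2) ^ 2) :=
          le_mul_of_one_le_right (by positivity) (by linarith)
      _ = ((E * (j + 1) : ℕ) : ℝ) * (ε₁ / 2) ^ 2 := by
          push_cast
          ring
  have key := core (sD := q.eval (j + 1)) hε (by positivity) hdn (two_pow_mul_exp_lt_one hε hjm) hn'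
  have h2e : 2 * (ε₁ / 2) = ε₁ := by ring
  rw [h2e] at key
  exact key

end Summit.QuantumAdvantage.QuantumAdvantage.Theorems.LiouvilleNotPPoly.OneTimePad

end
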